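import Literature.Analysis.FluidPDE.PeriodicCylinderTorusRepresentation
import HarnessLib

/-!
# Kato–Lai in the periodic cylinder: functions on the closed cylinder determined by the cell

Analysis/FluidPDE support file for the energy-method construction of Euler flows in the
periodic cylinder (`Literature.Analysis.FluidPDE.KatoLai1984_periodicCylinderUniformExistence`).
Two bookkeeping facts used to pass from `L²(cell)` identities to identities of smooth periodic
fields and of their torus representatives:

* `eqOn_closure_of_eqOn_cell` — two functions continuous on the closed cylinder `{r ≤ 1}`,
  `L`-periodic in `z` (`L > 0`), which agree on the open period cell `{r < 1, 0 < z < L}`, agree on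
  the closed cylinder (approach `(r, θ, z)`, `z ∈ [0, L]`, by the cell points
  `(θ' r, θ, L/2 + θ'(z − L/2))`, `θ' ↑ 1`; other heights by periodicity);
* `cylExtend_congr` — Seeley's periodic extension `cylExtend f` only depends on `f` on the closed
  cylinder (the reflected points `radialReflect k x` with non-zero weight lie in `{r ≤ 1}`), hence
  `torusRep_congr`.

Everything is proved; no named fact and no `sorry` is introduced.

## References

* R. T. Seeley, Proc. AMS 15 (1964) 625–626. [Seeley1964]
* T. Kato, C. Y. Lai, J. Funct. Anal. 56 (1984) 15–28. [KatoLai1984]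
-/

noncomputable section

open MeasureTheory Set Function Filter Topology TopologicalSpace
open scoped NNReal ENNReal InnerProductSpace RealInnerProductSpace

namespace Literature.Analysis.FluidPDE

open FunctionSpaces FunctionSpaces.Torus UnitAddTorus Literature.Analysis.Calculus

/-- Local notation for physical space `ℝ³ = EuclideanSpace ℝ (Fin 3)`. -/
local notation "ℝ³" => EuclideanSpace ℝ (Fin 3)

/-- Local notation for the closed cylinder `{r ≤ 1}`. -/
local notation "𝕂" => closure (SetLike.coe unitCylinder : Set (EuclideanSpace ℝ (Fin 3)))

namespace PeriodicCylinder

variable {L : ℝ}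

/-! ### Periodicity bookkeeping -/

/-- Iterated axial periodicity: `v (x + (kL) e_z) = v x` for `k ∈ ℤ` — verbatim twin of
`IsAxiallyPeriodic.add_int_mul` (`KatoLaiPeriodicCylinderProofs.lean`), kept as a deprecated alias
(librarian dedup-02139). [folklore] -/
@[deprecated IsAxiallyPeriodic.add_int_mul (since := "2026-08-16")]
alias IsAxiallyPeriodic.add_zsmul := IsAxiallyPeriodic.add_int_mul

/-! ### From the cell to the closed cylinder -/

/-- The radius of the approximating point `(θ x₀, θ x₁, ·)`. [folklore] -/
theorem cylRadius_approx (x : ℝ³) (θ c : ℝ) (hθ : 0 ≤ θ) :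
    cylRadius (WithLp.toLp 2 ![θ * x 0, θ * x 1, c] : ℝ³) = θ * cylRadius x := by
  rw [cylRadius, cylRadius]
  simp only [Matrix.cons_val_zero, Matrix.cons_val_one]
  rw [show (θ * x.ofLp 0) ^ 2 + (θ * x.ofLp 1) ^ 2 = θ ^ 2 * (x.ofLp 0 ^ 2 + x.ofLp 1 ^ 2) by ring,
    Real.sqrt_mul (sq_nonneg θ), Real.sqrt_sq hθ]

/-- **Functions continuous on the closed cylinder and periodic are determined by the open cell.**
[folklore] -/
theorem eqOn_closure_of_eqOn_cell {F : Type*} [NormedAddCommGroup F] (hL : 0 < L) {f g : ℝ³ → F}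
    (hf : ContinuousOn f 𝕂) (hg : ContinuousOn g 𝕂) (hfp : IsAxiallyPeriodic L f) (hgp : IsAxiallyPeriodic L g)
    (h : EqOn f g (cylinderCell L : Set ℝ³)) : EqOn f g 𝕂 := by
  set v : ℝ³ → F := fun x => f x - g x with hv
  have hvc : ContinuousOn v 𝕂 := hf.sub hg
  have hvp : IsAxiallyPeriodic L v := fun x => by show f _ - g _ = f x - g x; rw [hfp x, hgp x]
  have hv0 : ∀ x ∈ (cylinderCell L : Set ℝ³), v x = 0 := fun x hx => by show f x - g x = 0; rw [h hx, sub_self]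
  suffices key : ∀ y ∈ 𝕂, v y = 0 by
    intro x hx; have := key x hx; rwa [hv, sub_eq_zero] at this
  -- heights in `[0, L]`: approach from the cell
  have step : ∀ y ∈ 𝕂, y 2 ∈ Icc 0 L → v y = 0 := by
    intro y hy hz
    have hr : cylRadius y ≤ 1 := by rwa [closure_unitCylinder] at hy
    set γ : ℝ → ℝ³ := fun θ => WithLp.toLp 2 ![θ * y 0, θ * y 1, L / 2 + θ * (y 2 - L / 2)] with hγ
    have hγc : Continuous γ := by
      refine (PiLp.continuous_toLp 2 _).comp (continuous_pi fun i => ?_)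
      fin_cases i <;> simp <;> fun_prop
    have hγ1 : γ 1 = y := by
      ext i; fin_cases i <;> simp [hγ]
    have hγcell : ∀ θ ∈ Ioo (0 : ℝ) 1, γ θ ∈ (cylinderCell L : Set ℝ³) := by
      intro θ hθ
      rw [SetLike.mem_coe, mem_cylinderCell]
      refine ⟨?_, ?_, ?_⟩
      · rw [hγ, cylRadius_approx y θ _ hθ.1.le]
        calc θ * cylRadius y ≤ θ * 1 := mul_le_mul_of_nonneg_left hr hθ.1.le
          _ < 1 := by linarith [hθ.2]
      · show 0 < L / 2 + θ * (y 2 - L / 2)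
        nlinarith [hz.1, hz.2, hθ.1, hθ.2]
      · show L / 2 + θ * (y 2 - L / 2) < L
        nlinarith [hz.1, hz.2, hθ.1, hθ.2]
    have hγK : ∀ θ ∈ Ioo (0 : ℝ) 1, γ θ ∈ 𝕂 := fun θ hθ => subset_closure (cylinderCell_le_unitCylinder L (hγcell θ hθ))
    -- `v ∘ γ → v y` as `θ ↑ 1`, and `v ∘ γ = 0` on `(0, 1)`
    have ht : Tendsto γ (𝓝[Ioo 0 1] 1) (𝓝[𝕂] y) := by
      refine tendsto_nhdsWithin_iff.2 ⟨?_, eventually_nhdsWithin_of_forall hγK⟩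
      rw [← hγ1]; exact hγc.continuousAt.tendsto.mono_left nhdsWithin_le_nhds
    have hlim : Tendsto (v ∘ γ) (𝓝[Ioo 0 1] 1) (𝓝 (v y)) := (hvc y hy).tendsto.comp ht
    have hzero : Tendsto (v ∘ γ) (𝓝[Ioo 0 1] 1) (𝓝 0) :=
      tendsto_const_nhds.congr' (eventually_nhdsWithin_of_forall fun θ hθ => (hv0 _ (hγcell θ hθ)).symm)
    haveI : (𝓝[Ioo (0 : ℝ) 1] 1).NeBot := right_nhdsWithin_Ioo_neBot zero_lt_one
    exact tendsto_nhds_unique hlim hzero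
  -- general height: shift by `−⌊z/L⌋ L`
  intro y hy
  set k : ℤ := ⌊y 2 / L⌋ with hk
  set y' : ℝ³ := y + (((-k : ℤ) : ℝ) * L) • EuclideanSpace.single (2 : Fin 3) (1 : ℝ) with hy'
  have hy'K : y' ∈ 𝕂 := by
    rw [closure_unitCylinder, mem_setOf_eq] at hy ⊢
    have : cylRadius y' = cylRadius y := by rw [hy']; simp [cylRadius]
    rwa [this]
  have hz : y' 2 ∈ Icc 0 L := by
    have h2 : y' 2 = y 2 - ⌊y 2 / L⌋ * L := by simp [hy', hk]; ring
    rw [h2]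
    exact ⟨Int.sub_floor_div_mul_nonneg _ hL, (Int.sub_floor_div_mul_lt _ hL).le⟩
  have := step y' hy'K hz
  rwa [hy', IsAxiallyPeriodic.add_int_mul hvp] at this

/-! ### Seeley's extension only sees the closed cylinder -/

/-- **`cylExtend f` depends only on `f` on the closed cylinder.** [cite: Seeley1964, Theorem] -/
theorem cylExtend_congr {F : Type*} [NormedAddCommGroup F] [NormedSpace ℝ F] {f g : ℝ³ → F} (h : EqOn f g 𝕂) :
    cylExtend f = cylExtend g := by
  funext x
  unfold cylExtend
  by_cases hx : cylRadius x ≤ 1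
  · rw [rawExtend_of_le hx, rawExtend_of_le hx, h (by rwa [closure_unitCylinder])]
  · rw [not_le] at hx
    by_cases hfar : 5 / 4 ≤ cylRadius x
    · rw [cylRadialCutoff_eq_zero (by norm_num) (by norm_num) hfar, zero_smul, zero_smul]
    · rw [not_le] at hfar
      congr 1
      rw [rawExtend_of_one_lt hx, rawExtend_of_one_lt hx]
      refine tsum_congr fun k => ?_
      by_cases hw : Seeley.weight (1 / 2 : ℝ) k (1 - cylRadius x) = 0
      · rw [hw, zero_smul, zero_smul]
      · -- non-zero weight forces `2^k (r - 1) < 1/4`, so the reflected point lies in `{r ≤ 1}`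
        have hlt : (2 : ℝ) ^ k * (cylRadius x - 1) < 1 / 4 := by
          by_contra hge
          rw [not_lt] at hge
          apply hw
          refine Seeley.weight_eq_zero ?_
          rw [div_le_iff₀ (by norm_num : (0 : ℝ) < 1 / 2)]
          nlinarith
        have hmem : radialReflect k x ∈ 𝕂 := by
          rw [closure_unitCylinder, mem_setOf_eq, cylRadius_radialReflect (by linarith) (by linarith)]
          have : 0 < (2 : ℝ) ^ k * (cylRadius x - 1) := mul_pos (by positivity) (by linarith)
          linarith
        rw [h hmem]

/-- **Torus representatives depend only on the closed cylinder.** [folklore] -/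
theorem torusRep_congr {F : Type*} [NormedAddCommGroup F] [NormedSpace ℝ F] (L : ℝ) {f g : ℝ³ → F} (h : EqOn f g 𝕂) :
    torusRep L f = torusRep L g := by
  rw [torusRep, torusRep, cylExtend_congr h]

/-- Torus representatives of fields continuous on the closed cylinder and periodic which agree on
the cell. [folklore] -/
theorem torusRep_congr_of_eqOn_cell {F : Type*} [NormedAddCommGroup F] [NormedSpace ℝ F] (hL : 0 < L) {f g : ℝ³ → F}
    (hf : ContinuousOn f 𝕂) (hg : ContinuousOn g 𝕂) (hfp : IsAxiallyPeriodic L f) (hgp : IsAxiallyPeriodic L g)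
    (h : EqOn f g (cylinderCell L : Set ℝ³)) : torusRep L f = torusRep L g :=
  torusRep_congr L (eqOn_closure_of_eqOn_cell hL hf hg hfp hgp h)

end PeriodicCylinder

end Literature.Analysis.FluidPDE
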